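import Mathlib
import Literature.MathematicalPhysics.QuantumFieldTheory.Balaban1983to89.B16
import Literature.MathematicalPhysics.QuantumFieldTheory.Balaban1983to89.B16B10Shape

/-!
# `Balaban1983to89.B16PerBareCounter` — kernel COUNTER-MODELS: the bare-coupling reading `B16.UVBound01PerBare` of the
clause of (0.1) [Balaban1989LargeFieldII, p. 356] is NOT a consequence of the pinned end statement `B16.EndStatementBPrinted`,
and each extra hypothesis of `B16.uvBound01PerBare_of_cor3_floor` (local boundedness of the dependence functions e± of
[Balaban1988Convergent] Cor. 3; the flow inequality (2.6) of [Balaban1988Convergent] p. 255) is load-bearing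

CITATION HEADER (lean-in-tree rule 2026-08-18).  Cell `pub-balaban` (audit of T. Bałaban's lattice Yang–Mills series, CMP
1983–89), reader group B+C (unit `b2b-balaban-r2`, gen 9; revision v2 gen 10, §4), sibling of the typed skeleton
`…Balaban1983to89.B16` (the END STATEMENT (B) of the series: [Balaban1989LargeFieldII] = T. Bałaban, *Large field
renormalization. II*, Commun. Math. Phys. **122** (1989) 355–392, Theorem 1 p. 355 and (0.1) pp. 355–356;
[Balaban1988Convergent] = *Convergent renormalization expansions …*, Commun. Math. Phys. **119** (1988) 243–285, Cor. 3
(2.50) p. 264 and (2.6) p. 255).  WHAT THIS MODULE IS: bookkeeping about the cell's TYPED READINGS only — TOY inhabitants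
(two in v1, six from v2) of the statement-level carrier `B16.Construction` (one configuration and one lattice site per
step, χ_k ≡ 0, every abstract predicate `True`, densities ρ_k ≡ exp e(g_k) for a chosen exponent function `e`, resp.
exp k in M6), no lattice gauge field, NO printed content of the series asserted or used.  It answers cell
REFEREE R27.1 (iv) / GAPS G-ref2-19 (c) (referee ref2 gen 18, 2026-08-18): the sentence of `B16.lean` v7 (docstrings of
`UVBound01PerBare` and of the section «(0.1) read PER RUN and PER BARE COUPLING») and of `HOME/FINAL-STATEMENT.md` v8 §6 that
`UVBound01PerBare` is «NOT a consequence of the pin» was an independence claim WITHOUT a kernel witness.  Here are the witnesses.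

THE READINGS (all in `…B16` / `…B16B10Shape`, unchanged).  The pin `EndStatementBPrinted C = Thm1Printed C ∧ Cor3_250 C`
([III] Cor. 3: constants e±(g_k) "depending on g_k"); `UVBound01PerRun` (E± per run; a THEOREM of the pin given χ_k ≥ 0,
`B16.uvBound01PerRun_of_endStatementBPrinted`); `UVBound01PerBare` (E± depending on the bare coupling g_0 only, serving every
run from g_0 — every K, m, hence every lattice T_η); `B16B10Shape.UVBound01Compact` (E± per coupling window [g_min, γ]);
`UVBound01` (E± before the run).  On file: `UVBound01 ⇒ UVBound01Compact ⇒[(2.6)-floor] UVBound01PerBare ⇒ UVBound01PerRun`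
(`B16.uvBound01PerBare_of_window_floor`, `B16.uvBound01PerBare_of_cor3_floor`: pin + e± bounded above on every window
[g_min, γ] + the floor ∀ k ≤ K, g_0 ≤ (1+β₀) g_k).

MODEL M1 (`m1`, §2): run (K, m, g₀) has couplings g_k = g₀/(k+1) and ρ_k ≡ exp(1/g_k).  PROVED: `SignConventions`, `Thm1Printed`,
`Cor3With` at every γ with the witness e₋ ≡ 0, e₊(x) = 1/x — LOCALLY BOUNDED (indeed continuous) on ]0, γ] —, hence
`EndStatementBPrinted` and `B16B10Shape.UVBound01Compact`; and `¬ UVBound01PerBare` (the runs from one bare coupling g₀ reach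
g_K = g₀/(K+1) → 0, where e₊ = (K+1)/g₀ is unbounded).  Consequences: `pin_not_implies_perBare`, `compact_not_implies_perBare`
(pin + χ ≥ 0 + local boundedness + the compact-window reading do NOT give the bare-coupling reading), and — by the v7 theorem
`uvBound01PerBare_of_window_floor` read contrapositively — M1 violates the (2.6)-floor for every β₀ ≥ 0 at every γ > 0
(`m1_floor_fails`): in M1 the FLOOR is the missing hypothesis.

MODEL M2 (`m2`, §3): run (K, m, g₀) has couplings g_k = g₀·c_k, c_k = (k+2)/(2k+2) ∈ ]1/2, 1], c_0 = 1, decreasing — so the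
(2.6)-floor HOLDS with β₀ = 1 for every run at every γ (`m2_floor`) and the couplings decrease along the flow (`m2_antitone`) —
and ρ_k ≡ exp e(g_k) for ONE fixed function `codeExp : ℝ → ℝ` (chosen before everything) with `codeExp (c_k / 2^N) = k + 1`
(`codeExp_code`; the map (N, k) ↦ c_k/2^N is injective, `code_inj`): along the runs from g₀ = 2^{-N} the visited couplings
c_k/2^N, k ≤ K, stay in [2^{-N-1}, 2^{-N}] while e = k + 1 is unbounded as K → ∞.  PROVED: `SignConventions`, the pin, the
floor, and `¬ UVBound01PerBare`; consequences `pin_floor_not_implies_perBare` (pin + χ ≥ 0 + the (2.6)-floor do NOT give the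
bare-coupling reading), `m2_no_locally_bounded_witness` (NO [III]-Cor.-3 witness (e₋, e₊) of M2 is bounded above on every window
[g_min, γ] — by `uvBound01PerBare_of_cor3_floor` read contrapositively) and `m2_not_uvCompact`: in M2 LOCAL BOUNDEDNESS is the
missing hypothesis.  Together: each of the two extra hypotheses of `B16.uvBound01PerBare_of_cor3_floor` is load-bearing, and
`UVBound01PerRun` (which both models satisfy, `m1_perRun`, `m2_perRun`) is strictly weaker than `UVBound01PerBare` on the
carrier.

REVISION v2 (§4, APPEND-ONLY; §1–§3 unchanged).  (a) Models M5(β₀) for EVERY β₀ > 0 (M2 = M5(1), `cM5_one`): the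
(2.6)-floor with THE GIVEN parameter β₀ — print, p. 255: *"β₀ > 0 can be chosen arbitrarily small, if g is sufficiently
small"* — still does not give the bare-coupling reading (`pin_floor_not_implies_perBare_sharp`,
`perRun_floor_not_implies_perBare`; §3's `pin_floor_not_implies_perBare` quantifies β₀ under the negation, witness β₀ = 1).
(b) The constant-flow models M3, M4 and the floor-free theorem `perRun_of_compact` (compact window ⇒ per run, for every
construction) complete the SEPARATION of the four typed readings U = `B16.UVBound01`, C = `B16B10Shape.UVBound01Compact`,
B = `B16.UVBound01PerBare`, R = `B16.UVBound01PerRun` on the carrier: WITHOUT the floor a diamond (U ⊊ C ⊊ R, U ⊊ B ⊊ R,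
C and B incomparable: M1 has C ∧ ¬B, M3 has B ∧ ¬C), WITH the floor the strict chain U ⊊ C ⊊ B ⊊ R (M4, M3, M5(β₀)).
(c) Model M6 (densities indexed by the step): the pin is strictly above R (`perRun_not_implies_cor3`,
`perRun_floor_not_implies_pin`).  The by-name bridge C ∧ floor ⇒ B is meanwhile in the tree
(`B16B10Shape.uvPerBare_of_uvCompact_floor`, sibling v2.2 §5) and is used here (`m5_not_uvCompact`).  Table: §4 docstring.

HONEST LABELLING.  The models are about the LOGICAL FORM of the cell's typed readings (quantifier order over the family of
runs), exactly as `B16B10Shape.not_uvBound01_of_smallCouplings` and `T4FiniteEpsInhabited.not_endStatementBPrinted_stub` are;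
they say nothing about T. Bałaban's densities, for which (2.6) is printed ([Balaban1988Convergent] p. 255 — itself the cell's
located unproved-in-print step (i), hypothesis `B14FlowStep` / `B14.FlowIneq26`, `HOME/MISSING-B14.md`) and e± are whatever
§1 of [Balaban1989LargeFieldII] produces.  (B) = `B16.EndStatementBPrinted`, CONDITIONAL on g_k ∈ ]0, γ], is untouched.
Unit `b2b-balaban-r2` gen 9 (journal claim G-ref2-19c-UPTAKE); companion prose `HOME/FINAL-STATEMENT.md` v9 §6 / §6d(2);
cell GAPS C-r2.26.  Revision v2: gen 10 (journal claim PERBARE-SEPARATION); `HOME/FINAL-STATEMENT.md` v10 §6 / §6c /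
§6d(2); cell GAPS C-r2.27, DIVERGENCE D-r2.14.  value = kernel witness for an independence claim + typed-statement
precision, NOT summit progress.
-/

namespace Literature.MathematicalPhysics.QuantumFieldTheory.Balaban1983to89.B16PerBareCounter

open Literature.MathematicalPhysics.QuantumFieldTheory.Balaban1983to89

noncomputable section

/-! ## §1. The toy carrier and its generic properties -/

/-- Toy run data over a coupling sequence `g` and an exponent function `e`: β-functions 0, ONE configuration (`Unit`) and ONE
lattice site per step, `dom = univ`, `effAction = wilsonBG = Ek ≡ 0`, `Repr = IndAss = Sect2Form ≡ True`, `χ ≡ 0`, and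
`ρ_k ≡ exp (e (g k))`.  No lattice gauge field; a statement-level inhabitant only. [folklore] -/
def toyRun (g : ℕ → ℝ) (e : ℝ → ℝ) : B16.RunData where
  flow := ⟨g, fun _ _ => 0⟩
  Cfg := fun _ => Unit
  dom := fun _ => Set.univ
  effAction := fun _ _ => 0
  wilsonBG := fun _ _ => 0
  Ek := fun _ _ => 0
  numSites := fun _ => 1
  Repr := fun _ => True
  IndAss := fun _ => True
  ρ := fun k _ => Real.exp (e (g k))
  χ := fun _ _ => 0
  Sect2Form := fun _ => True

/-- The toy construction: run parameters ↦ toy run data with couplings `gs P`. [folklore] -/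
def toy (gs : B12.RunParams → ℕ → ℝ) (e : ℝ → ℝ) : B16.Construction := fun P => toyRun (gs P) e

/-- The couplings of a toy run. [folklore] -/
@[simp] theorem toy_g (gs : B12.RunParams → ℕ → ℝ) (e : ℝ → ℝ) (P : B12.RunParams) (k : ℕ) :
    ((toy gs e) P).flow.g k = gs P k := rfl

/-- The densities of a toy run. [folklore] -/
@[simp] theorem toy_ρ (gs : B12.RunParams → ℕ → ℝ) (e : ℝ → ℝ) (P : B12.RunParams) (k : ℕ) (V : ((toy gs e) P).Cfg k) :
    ((toy gs e) P).ρ k V = Real.exp (e (gs P k)) := rfl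

/-- The characteristic functions of a toy run vanish. [folklore] -/
@[simp] theorem toy_χ (gs : B12.RunParams → ℕ → ℝ) (e : ℝ → ℝ) (P : B12.RunParams) (k : ℕ) (V : ((toy gs e) P).Cfg k) :
    ((toy gs e) P).χ k V = 0 := rfl

/-- A toy run has one lattice site per step. [folklore] -/
@[simp] theorem toy_numSites (gs : B12.RunParams → ℕ → ℝ) (e : ℝ → ℝ) (P : B12.RunParams) (k : ℕ) :
    ((toy gs e) P).numSites k = 1 := rfl

/-- The two-sided inequality in a toy model reduces to `e (g k) ≤ Ep` (χ ≡ 0 kills the lower bound; one site). [folklore] -/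
theorem toy_uvIneq_iff (gs : B12.RunParams → ℕ → ℝ) (e : ℝ → ℝ) (P : B12.RunParams) (k : ℕ)
    (V : ((toy gs e) P).Cfg k) (Em Ep : ℝ) :
    B16.UVIneq ((toy gs e) P) k V Em Ep ↔ e (gs P k) ≤ Ep := by
  unfold B16.UVIneq
  simp only [toy_χ, toy_ρ, toy_numSites, Nat.cast_one, mul_one, zero_mul]
  constructor
  · rintro ⟨-, h⟩
    exact Real.exp_le_exp.mp h
  · intro h
    exact ⟨(Real.exp_pos _).le, Real.exp_le_exp.mpr h⟩

/-- Sign convention `χ_k ≥ 0` (χ ≡ 0). [folklore] -/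
theorem toy_sign (gs : B12.RunParams → ℕ → ℝ) (e : ℝ → ℝ) : B16.SignConventions (toy gs e) :=
  fun _ _ _ => le_rfl

/-- Theorem 1's printed conditional form holds trivially (`Sect2Form ≡ True`). [folklore] -/
theorem toy_thm1 (gs : B12.RunParams → ℕ → ℝ) (e : ℝ → ℝ) : B16.Thm1Printed (toy gs e) :=
  ⟨1, one_pos, fun _ _ _ _ => trivial⟩

/-- [III] Cor. 3's form holds at EVERY γ with the witness `e₋ ≡ 0`, `e₊ = e` (equality in the upper bound). [folklore] -/
theorem toy_cor3With (gs : B12.RunParams → ℕ → ℝ) (e : ℝ → ℝ) (γ : ℝ) :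
    B16.Cor3With (toy gs e) γ (fun _ => 0) e := by
  intro P _ k _ V
  exact (toy_uvIneq_iff gs e P k V 0 (e (gs P k))).mpr le_rfl

/-- [III] Cor. 3 in its printed conditional form. [folklore] -/
theorem toy_cor3 (gs : B12.RunParams → ℕ → ℝ) (e : ℝ → ℝ) : B16.Cor3_250 (toy gs e) :=
  ⟨1, one_pos, fun _ => 0, e, toy_cor3With gs e 1⟩

/-- The pinned end statement (B) = Theorem 1 ∧ [III] Cor. 3 holds in every toy model. [folklore] -/
theorem toy_pin (gs : B12.RunParams → ℕ → ℝ) (e : ℝ → ℝ) : B16.EndStatementBPrinted (toy gs e) :=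
  ⟨toy_thm1 gs e, toy_cor3 gs e⟩

/-- Hence (0.1) PER RUN holds in every toy model (the v6 theorem of `…B16`). [folklore] -/
theorem toy_perRun (gs : B12.RunParams → ℕ → ℝ) (e : ℝ → ℝ) : B16.UVBound01PerRun (toy gs e) :=
  B16.uvBound01PerRun_of_endStatementBPrinted _ (toy_sign gs e) (toy_pin gs e)

/-- Generic refutation of the bare-coupling reading: if below every γ > 0 there is a bare coupling g₀ ∈ ]0, γ] from which,
for every proposed E₊, some run of the ]0, γ]-family reaches a step where `e (g_k) > E₊`, then `¬ UVBound01PerBare`. [folklore] -/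
theorem toy_not_perBare (gs : B12.RunParams → ℕ → ℝ) (e : ℝ → ℝ)
    (h : ∀ γ : ℝ, 0 < γ → ∃ g₀ : ℝ, 0 < g₀ ∧ g₀ ≤ γ ∧ ∀ Ep : ℝ, ∃ P : B12.RunParams,
      ((toy gs e) P).flow.InInterval γ P.K ∧ gs P 0 = g₀ ∧ ∃ k, k ≤ P.K ∧ Ep < e (gs P k)) :
    ¬ B16.UVBound01PerBare (toy gs e) := by
  rintro ⟨γ, hγ, H⟩
  obtain ⟨g₀, hg₀, hle, Hbad⟩ := h γ hγ
  obtain ⟨Em, Ep, HE⟩ := H g₀ hg₀ hle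
  obtain ⟨P, hP, h0, k, hk, hlt⟩ := Hbad Ep
  have hE : e (gs P k) ≤ Ep := (toy_uvIneq_iff gs e P k () Em Ep).mp (HE P hP h0 k hk ())
  exact absurd hE (not_le.mpr hlt)

/-! ## §2. Model M1 — couplings g₀/(k+1), ρ_k ≡ exp(1/g_k): pin + local boundedness + compact window, NO floor -/

/-- M1's coupling scheme: `g_k = g₀/(k+1)` for the run `(K, m, g₀)`. [folklore] -/
def gsM1 (P : B12.RunParams) (k : ℕ) : ℝ := P.g0 / ((k : ℝ) + 1)

/-- Model M1: `toy gsM1 (fun x => 1/x)`. [folklore] -/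
def m1 : B16.Construction := toy gsM1 (fun x => 1 / x)

/-- M1's bare coupling is `g₀`. [folklore] -/
theorem gsM1_zero (P : B12.RunParams) : gsM1 P 0 = P.g0 := by
  simp [gsM1]

/-- A run `(K, m, g₀)` with `0 < g₀ ≤ γ` lies in the ]0, γ]-family of M1. [folklore] -/
theorem m1_inInterval (γ : ℝ) (K m : ℕ) (g₀ : ℝ) (hg₀ : 0 < g₀) (hle : g₀ ≤ γ) :
    (m1 ⟨K, m, g₀⟩).flow.InInterval γ K := by
  intro k _
  have hk : (0 : ℝ) < (k : ℝ) + 1 := by positivity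
  refine ⟨?_, ?_⟩
  · show 0 < g₀ / ((k : ℝ) + 1)
    exact div_pos hg₀ hk
  · show g₀ / ((k : ℝ) + 1) ≤ γ
    exact le_trans (div_le_self hg₀.le (by linarith)) hle

/-- M1: sign convention. [folklore] -/
theorem m1_sign : B16.SignConventions m1 := toy_sign _ _

/-- M1: [III] Cor. 3's form at every γ with `e₋ ≡ 0`, `e₊(x) = 1/x`. [folklore] -/
theorem m1_cor3With (γ : ℝ) : B16.Cor3With m1 γ (fun _ => 0) (fun x => 1 / x) := toy_cor3With _ _ γ

/-- M1: the pinned end statement (B) holds. [folklore] -/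
theorem m1_pin : B16.EndStatementBPrinted m1 := toy_pin _ _

/-- M1: (0.1) per run holds. [folklore] -/
theorem m1_perRun : B16.UVBound01PerRun m1 := toy_perRun _ _

/-- M1's Cor. 3 witness is bounded above on every coupling window `[g_min, γ]`, `g_min > 0` — exactly the hypothesis `hbdd` of
`B16.uvBound01PerBare_of_cor3_floor` (E₋ = 0, E₊ = 1/g_min). [folklore] -/
theorem m1_witness_locallyBounded (γ gmin : ℝ) (hmin : 0 < gmin) :
    (∃ Em : ℝ, ∀ x, gmin ≤ x → x ≤ γ → (fun _ : ℝ => (0 : ℝ)) x ≤ Em) ∧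
      (∃ Ep : ℝ, ∀ x, gmin ≤ x → x ≤ γ → (fun x : ℝ => 1 / x) x ≤ Ep) := by
  refine ⟨⟨0, fun _ _ _ => le_rfl⟩, ⟨1 / gmin, fun x hx _ => ?_⟩⟩
  exact one_div_le_one_div_of_le hmin hx

/-- M1's witness `e₊(x) = 1/x` is even continuous on the half-open interval ]0, γ] (the hypothesis of
`B16B10Shape.uvCompact_of_cor3_continuousOn_Ioc`). [folklore] -/
theorem m1_witness_continuousOn (γ : ℝ) : ContinuousOn (fun x : ℝ => 1 / x) (Set.Ioc 0 γ) := by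
  have h : ContinuousOn (fun x : ℝ => x⁻¹) (Set.Ioc 0 γ) :=
    continuousOn_inv₀.mono fun x hx => ne_of_gt hx.1
  simpa [one_div] using h

/-- M1: the window statement at every γ and every `g_min > 0` (E₋ = 0, E₊ = 1/g_min) — `B16B10Shape.UV01Window` by that
module's `uvWindow_of_cor3`. [folklore] -/
theorem m1_window (γ gmin : ℝ) (hmin : 0 < gmin) : B16B10Shape.UV01Window m1 γ gmin 0 (1 / gmin) :=
  B16B10Shape.uvWindow_of_cor3 m1 γ gmin (fun _ => 0) (fun x => 1 / x) 0 (1 / gmin) m1_sign (m1_cor3With γ)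
    (fun _ _ _ => le_rfl) (fun _ hx _ => one_div_le_one_div_of_le hmin hx)

/-- M1: the compact-window reading `B16B10Shape.UVBound01Compact` holds. [folklore] -/
theorem m1_uvCompact : B16B10Shape.UVBound01Compact m1 :=
  ⟨1, one_pos, fun gmin hmin _ => ⟨0, 1 / gmin, m1_window 1 gmin hmin⟩⟩

/-- M1: the bare-coupling reading FAILS — from g₀ = γ the run with K = ⌈E₊·γ⌉₊ steps reaches g_K = γ/(K+1), where
e₊ = (K+1)/γ > E₊. [folklore] -/
theorem m1_not_perBare : ¬ B16.UVBound01PerBare m1 := by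
  refine toy_not_perBare gsM1 (fun x => 1 / x) fun γ hγ => ⟨γ, hγ, le_rfl, fun Ep => ?_⟩
  refine ⟨⟨⌈Ep * γ⌉₊, 0, γ⟩, m1_inInterval γ _ 0 γ hγ le_rfl, gsM1_zero _, ⌈Ep * γ⌉₊, le_rfl, ?_⟩
  have hK : Ep * γ < (⌈Ep * γ⌉₊ : ℝ) + 1 := lt_of_le_of_lt (Nat.le_ceil _) (lt_add_one _)
  show Ep < 1 / (γ / ((⌈Ep * γ⌉₊ : ℝ) + 1))
  rw [one_div_div, lt_div_iff₀ hγ]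
  exact hK

/-- M1 violates the (2.6)-floor `g_0 ≤ (1+β₀) g_k` for EVERY β₀ ≥ 0, at every γ > 0 — proved from the v7 theorem
`B16.uvBound01PerBare_of_window_floor` read contrapositively: in M1 the floor is the missing hypothesis. [folklore] -/
theorem m1_floor_fails (γ : ℝ) (hγ : 0 < γ) (β₀ : ℝ) (hβ₀ : 0 ≤ β₀) :
    ¬ ∀ P : B12.RunParams, (m1 P).flow.InInterval γ P.K →
      ∀ k, k ≤ P.K → (m1 P).flow.g 0 ≤ (1 + β₀) * (m1 P).flow.g k :=
  fun hfloor => m1_not_perBare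
    (B16.uvBound01PerBare_of_window_floor m1 γ hγ β₀ hβ₀ (fun gmin hmin _ => ⟨0, 1 / gmin, m1_window γ gmin hmin⟩) hfloor)

/-- **The pin does not imply the bare-coupling reading** (given χ_k ≥ 0): witnessed by M1. [folklore] -/
theorem pin_not_implies_perBare :
    ¬ ∀ C : B16.Construction, B16.SignConventions C → B16.EndStatementBPrinted C → B16.UVBound01PerBare C :=
  fun h => m1_not_perBare (h m1 m1_sign m1_pin)

/-- **Nor does the compact-window reading** (pin + χ_k ≥ 0 + `B16B10Shape.UVBound01Compact`; M1's witness e± is moreover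
locally bounded and continuous on ]0, γ]): without the (2.6)-floor the bare-coupling reading does not follow. [folklore] -/
theorem compact_not_implies_perBare :
    ¬ ∀ C : B16.Construction, B16.SignConventions C → B16.EndStatementBPrinted C →
      B16B10Shape.UVBound01Compact C → B16.UVBound01PerBare C :=
  fun h => m1_not_perBare (h m1 m1_sign m1_pin m1_uvCompact)

/-! ## §3. Model M2 — couplings g₀·(k+2)/(2k+2), ρ_k ≡ exp codeExp(g_k): pin + the (2.6)-floor, NO local boundedness -/

/-- The profile `c_k = (k+2)/(2k+2)`: `c_0 = 1`, `1/2 < c_k ≤ 1`, strictly decreasing. [folklore] -/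
def cM2 (k : ℕ) : ℝ := ((k : ℝ) + 2) / (2 * (k : ℝ) + 2)

/-- `c_0 = 1`. [folklore] -/
theorem cM2_zero : cM2 0 = 1 := by norm_num [cM2]

/-- The denominator `2k+2` is positive. [folklore] -/
theorem cM2_pos_den (k : ℕ) : (0 : ℝ) < 2 * (k : ℝ) + 2 := by positivity

/-- `c_k = 1/2 + 1/(2k+2)`. [folklore] -/
theorem cM2_eq (k : ℕ) : cM2 k = 1 / 2 + 1 / (2 * (k : ℝ) + 2) := by
  have h := cM2_pos_den k
  unfold cM2
  field_simp
  ring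

/-- `1/2 < c_k`. [folklore] -/
theorem half_lt_cM2 (k : ℕ) : (1 : ℝ) / 2 < cM2 k := by
  rw [cM2_eq]
  have : (0 : ℝ) < 1 / (2 * (k : ℝ) + 2) := by positivity
  linarith

/-- `c_k ≤ 1`. [folklore] -/
theorem cM2_le_one (k : ℕ) : cM2 k ≤ 1 := by
  rw [cM2, div_le_one (cM2_pos_den k)]
  have : (0 : ℝ) ≤ k := Nat.cast_nonneg k
  linarith

/-- `0 < c_k`. [folklore] -/
theorem cM2_pos (k : ℕ) : 0 < cM2 k := lt_trans (by norm_num) (half_lt_cM2 k)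

/-- `c` is strictly decreasing. [folklore] -/
theorem cM2_strictAnti : StrictAnti cM2 := by
  intro a b hab
  rw [cM2_eq, cM2_eq]
  have ha := cM2_pos_den a
  have hab' : (2 * (a : ℝ) + 2) < 2 * (b : ℝ) + 2 := by
    have : (a : ℝ) < b := Nat.cast_lt.mpr hab
    linarith
  have := one_div_lt_one_div_of_lt ha hab'
  linarith

/-- `c` is injective. [folklore] -/
theorem cM2_injective : Function.Injective cM2 := cM2_strictAnti.injective

/-- M2's coupling scheme: `g_k = g₀·c_k` for the run `(K, m, g₀)`; `g_0 = g₀`. [folklore] -/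
def gsM2 (P : B12.RunParams) (k : ℕ) : ℝ := P.g0 * cM2 k

/-- M2's bare coupling is `g₀`. [folklore] -/
theorem gsM2_zero (P : B12.RunParams) : gsM2 P 0 = P.g0 := by
  simp [gsM2, cM2_zero]

/-- The code `(N, k) ↦ c_k / 2^N`. [folklore] -/
def code (N k : ℕ) : ℝ := cM2 k / (2 : ℝ) ^ N

/-- `0 < 2^N`. [folklore] -/
theorem two_pow_pos' (N : ℕ) : (0 : ℝ) < (2 : ℝ) ^ N := by positivity

/-- `1/(2·2^N) < code N k ≤ 1/2^N`. [folklore] -/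
theorem code_bounds (N k : ℕ) : 1 / (2 * (2 : ℝ) ^ N) < code N k ∧ code N k ≤ 1 / (2 : ℝ) ^ N := by
  have hN := two_pow_pos' N
  refine ⟨?_, ?_⟩
  · unfold code
    rw [div_lt_div_iff₀ (by positivity) hN]
    have h := half_lt_cM2 k
    have : 1 * (2 : ℝ) ^ N = (1 / 2) * (2 * (2 : ℝ) ^ N) := by ring
    rw [this]
    exact mul_lt_mul_of_pos_right h (by positivity)
  · unfold code
    exact div_le_div_of_nonneg_right (cM2_le_one k) hN.le |>.trans (le_of_eq rfl)

/-- The code is injective: the dyadic scale N is read off from `1/(2·2^N) < x ≤ 1/2^N`, then k from `c` injective. [folklore] -/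
theorem code_inj {N k N' k' : ℕ} (h : code N k = code N' k') : N = N' ∧ k = k' := by
  have hb := code_bounds N k
  have hb' := code_bounds N' k'
  -- first N = N'
  have key : ∀ {M M' : ℕ} {x : ℝ}, 1 / (2 * (2 : ℝ) ^ M) < x → x ≤ 1 / (2 : ℝ) ^ M' → ¬ M < M' := by
    intro M M' x hlow hup hlt
    have hpow : (2 : ℝ) ^ (M + 1) ≤ (2 : ℝ) ^ M' := pow_le_pow_right₀ (by norm_num) hlt
    have h1 : 1 / (2 : ℝ) ^ M' ≤ 1 / (2 : ℝ) ^ (M + 1) :=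
      one_div_le_one_div_of_le (by positivity) hpow
    have h2 : (2 : ℝ) ^ (M + 1) = 2 * (2 : ℝ) ^ M := by ring
    rw [h2] at h1
    linarith
  have hNN : N = N' := by
    rcases lt_trichotomy N N' with hlt | heq | hgt
    · exact absurd hlt (key hb.1 (h ▸ hb'.2))
    · exact heq
    · exact absurd hgt (key hb'.1 (h.symm ▸ hb.2))
  subst hNN
  refine ⟨rfl, cM2_injective ?_⟩
  have hN := two_pow_pos' N
  unfold code at h
  field_simp at h
  linarith [h]

open Classical in
/-- ONE exponent function for the whole model, chosen before every run: on a code value it returns `k + 1`, elsewhere 0. [folklore] -/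
def codeExp (x : ℝ) : ℝ :=
  if h : ∃ p : ℕ × ℕ, x = code p.1 p.2 then ((Classical.choose h).2 : ℝ) + 1 else 0

/-- `codeExp (code N k) = k + 1`. [folklore] -/
theorem codeExp_code (N k : ℕ) : codeExp (code N k) = (k : ℝ) + 1 := by
  have h : ∃ p : ℕ × ℕ, code N k = code p.1 p.2 := ⟨(N, k), rfl⟩
  rw [codeExp, dif_pos h]
  have hspec := Classical.choose_spec h
  obtain ⟨-, hk⟩ := code_inj hspec
  rw [← hk]

/-- Model M2: `toy gsM2 codeExp`. [folklore] -/
def m2 : B16.Construction := toy gsM2 codeExp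

/-- A run `(K, m, g₀)` with `0 < g₀ ≤ γ` lies in the ]0, γ]-family of M2. [folklore] -/
theorem m2_inInterval (γ : ℝ) (K m : ℕ) (g₀ : ℝ) (hg₀ : 0 < g₀) (hle : g₀ ≤ γ) :
    (m2 ⟨K, m, g₀⟩).flow.InInterval γ K := by
  intro k _
  refine ⟨?_, ?_⟩
  · show 0 < g₀ * cM2 k
    exact mul_pos hg₀ (cM2_pos k)
  · show g₀ * cM2 k ≤ γ
    exact le_trans (mul_le_of_le_one_right hg₀.le (cM2_le_one k)) hle

/-- M2: sign convention. [folklore] -/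
theorem m2_sign : B16.SignConventions m2 := toy_sign _ _

/-- M2: [III] Cor. 3's form at every γ with `e₋ ≡ 0`, `e₊ = codeExp`. [folklore] -/
theorem m2_cor3With (γ : ℝ) : B16.Cor3With m2 γ (fun _ => 0) codeExp := toy_cor3With _ _ γ

/-- M2: the pinned end statement (B) holds. [folklore] -/
theorem m2_pin : B16.EndStatementBPrinted m2 := toy_pin _ _

/-- M2: (0.1) per run holds. [folklore] -/
theorem m2_perRun : B16.UVBound01PerRun m2 := toy_perRun _ _

/-- M2: the couplings DECREASE along every run of the family (consistent with β-functions ≥ 0). [folklore] -/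
theorem m2_antitone (P : B12.RunParams) (hg : 0 ≤ P.g0) : Antitone (fun k => (m2 P).flow.g k) := by
  intro a b hab
  show P.g0 * cM2 b ≤ P.g0 * cM2 a
  exact mul_le_mul_of_nonneg_left (cM2_strictAnti.antitone hab) hg

/-- M2 SATISFIES the (2.6)-floor with β₀ = 1 — `g_0 ≤ 2 g_k` for every run of the ]0, γ]-family, at every γ. [folklore] -/
theorem m2_floor (γ : ℝ) : ∀ P : B12.RunParams, (m2 P).flow.InInterval γ P.K →
    ∀ k, k ≤ P.K → (m2 P).flow.g 0 ≤ (1 + 1) * (m2 P).flow.g k := by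
  intro P hP k _
  have h0 : 0 < (m2 P).flow.g 0 := (hP 0 (Nat.zero_le _)).1
  have hg0 : 0 < P.g0 := by
    have : (m2 P).flow.g 0 = P.g0 := gsM2_zero P
    linarith
  show P.g0 * cM2 0 ≤ (1 + 1) * (P.g0 * cM2 k)
  rw [cM2_zero, mul_one]
  have hc := half_lt_cM2 k
  nlinarith

/-- Below every γ > 0 there is a dyadic bare coupling `2^{-N} ≤ γ`. [folklore] -/
theorem exists_dyadic_le (γ : ℝ) (hγ : 0 < γ) : ∃ N : ℕ, 1 / (2 : ℝ) ^ N ≤ γ := by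
  obtain ⟨N, hN⟩ := exists_nat_gt (1 / γ)
  refine ⟨N, ?_⟩
  have h2 : (N : ℝ) < (2 : ℝ) ^ N := by exact_mod_cast Nat.lt_two_pow_self
  have hpos : (0 : ℝ) < (2 : ℝ) ^ N := two_pow_pos' N
  rw [div_le_iff₀ hpos]
  have : 1 / γ * γ = 1 := by field_simp
  nlinarith [mul_lt_mul_of_pos_right (lt_trans hN h2) hγ]

/-- M2: the bare-coupling reading FAILS — from g₀ = 2^{-N} the run with K = ⌈E₊⌉₊ steps reaches the coupling
`code N K = c_K/2^N ∈ [2^{-N-1}, 2^{-N}]`, where `codeExp = K + 1 > E₊`. [folklore] -/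
theorem m2_not_perBare : ¬ B16.UVBound01PerBare m2 := by
  refine toy_not_perBare gsM2 codeExp fun γ hγ => ?_
  obtain ⟨N, hN⟩ := exists_dyadic_le γ hγ
  have hg₀ : 0 < 1 / (2 : ℝ) ^ N := by positivity
  refine ⟨1 / (2 : ℝ) ^ N, hg₀, hN, fun Ep => ?_⟩
  refine ⟨⟨⌈Ep⌉₊, 0, 1 / (2 : ℝ) ^ N⟩, m2_inInterval γ _ 0 _ hg₀ hN, gsM2_zero _, ⌈Ep⌉₊, le_rfl, ?_⟩
  have hcode : gsM2 ⟨⌈Ep⌉₊, 0, 1 / (2 : ℝ) ^ N⟩ ⌈Ep⌉₊ = code N ⌈Ep⌉₊ := by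
    show 1 / (2 : ℝ) ^ N * cM2 ⌈Ep⌉₊ = cM2 ⌈Ep⌉₊ / (2 : ℝ) ^ N
    rw [one_div_mul_eq_div]
  rw [hcode, codeExp_code]
  exact lt_of_le_of_lt (Nat.le_ceil _) (lt_add_one _)

/-- **Pin + χ_k ≥ 0 + the (2.6)-floor do not imply the bare-coupling reading**: witnessed by M2 (floor with β₀ = 1 at every
γ). [folklore] -/
theorem pin_floor_not_implies_perBare :
    ¬ ∀ C : B16.Construction, ∀ β₀ : ℝ, 0 ≤ β₀ → B16.SignConventions C → B16.EndStatementBPrinted C →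
      (∀ γ : ℝ, 0 < γ → ∀ P : B12.RunParams, (C P).flow.InInterval γ P.K →
        ∀ k, k ≤ P.K → (C P).flow.g 0 ≤ (1 + β₀) * (C P).flow.g k) →
      B16.UVBound01PerBare C :=
  fun h => m2_not_perBare (h m2 1 zero_le_one m2_sign m2_pin fun γ _ => m2_floor γ)

/-- In M2 NO [III]-Cor.-3 witness (e₋, e₊), at any γ > 0, is bounded above on every coupling window [g_min, γ] — from the v7
theorem `B16.uvBound01PerBare_of_cor3_floor` read contrapositively: in M2 local boundedness is the missing hypothesis. [folklore] -/
theorem m2_no_locally_bounded_witness (γ : ℝ) (hγ : 0 < γ) (em ep : ℝ → ℝ) (hcor : B16.Cor3With m2 γ em ep) :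
    ¬ ∀ gmin : ℝ, 0 < gmin → gmin ≤ γ →
      (∃ Em : ℝ, ∀ x, gmin ≤ x → x ≤ γ → em x ≤ Em) ∧ (∃ Ep : ℝ, ∀ x, gmin ≤ x → x ≤ γ → ep x ≤ Ep) :=
  fun hbdd => m2_not_perBare
    (B16.uvBound01PerBare_of_cor3_floor m2 m2_sign γ hγ em ep hcor hbdd 1 zero_le_one (m2_floor γ))

/-- M2 does NOT satisfy the compact-window reading (else the floor would give the bare-coupling reading by
`B16.uvBound01PerBare_of_window_floor`). [folklore] -/
theorem m2_not_uvCompact : ¬ B16B10Shape.UVBound01Compact m2 := by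
  rintro ⟨γ, hγ, hwin⟩
  exact m2_not_perBare (B16.uvBound01PerBare_of_window_floor m2 γ hγ 1 zero_le_one hwin (m2_floor γ))

/-- Summary — a MODEL-FREE statement (its proof below uses M1; M2 witnesses it equally: `m2_perRun`, `m2_not_perBare`;
cell GAPS C-pv06-18 micro-remark R1): on the carrier, `UVBound01PerRun` is STRICTLY weaker than `UVBound01PerBare` (both
models satisfy the former and refute the latter), and neither «pin + local boundedness (+ compact window)» (M1) nor «pin +
(2.6)-floor» (M2) reaches the latter; §4 sharpens the second to every floor parameter β₀ > 0
(`perRun_floor_not_implies_perBare`). [folklore] -/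
theorem perRun_not_implies_perBare :
    ¬ ∀ C : B16.Construction, B16.SignConventions C → B16.UVBound01PerRun C → B16.UVBound01PerBare C :=
  fun h => m1_not_perBare (h m1 m1_sign m1_perRun)

/-! ## §4. (revision v2, append-only) Every floor parameter β₀ > 0 (models M5(β₀) ⊇ M2), the constant-flow models M3 and
M4, the step-indexed model M6, and the COMPLETE SEPARATION of the four typed readings of the (0.1) clause on the carrier

WHY (unit `b2b-balaban-r2` gen 10, journal claim PERBARE-SEPARATION; cell GAPS C-r2.27, DIVERGENCE D-r2.14).
(a) SHARP FLOOR PARAMETER.  Print, (2.6) of [Balaban1988Convergent] p. 255: *"… and β₀ > 0 can be chosen arbitrarily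
small, if g is sufficiently small."* — the relevant floor parameter is a SMALL β₀ > 0, whereas §3's
`pin_floor_not_implies_perBare` quantifies β₀ under the negation and is witnessed at β₀ = 1 only (M2).  Model M5(β₀)
(`m5 β₀`, §4.3) is M2 with the profile c_k = λ + (1 − λ)/(k+1), λ = (1+β₀)⁻¹ (`cM5`; M2's profile is the case β₀ = 1,
`cM5_one`): c_0 = 1, λ < c_k ≤ 1, strictly decreasing, so (1+β₀) c_k > 1 and the run-by-run floor `g_0 ≤ (1+β₀) g_k`
holds WITH THE GIVEN β₀ at every γ (`m5_floor`); the exponent function is again ONE fixed `codeExp5 β₀` with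
`codeExp5 β₀ (λ^N c_k) = k + 1` (`code5_inj`: the scale N is read off from λ^{N+1} < x ≤ λ^N).  PROVED for every β₀ > 0:
sign, pin, floor(β₀) and `¬ UVBound01PerBare` (`m5_not_perBare`), hence `pin_floor_not_implies_perBare_sharp β₀` and
`perRun_floor_not_implies_perBare β₀` — no floor parameter, however small, turns the pin (or the per-run reading) into the
bare-coupling reading without local boundedness of e±.
(b) THE REMAINING ARROWS (r2-g9 NEXT (3)).  Two CONSTANT-FLOW models, g_k ≡ g₀ (`gsConst`, §4.2: every floor holds,
`const_floor`, and the bare-coupling reading holds for EVERY exponent function, `const_perBare`, since a run from g₀ only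
ever visits the coupling g₀): M3 = `toy gsConst codeExp` has the bare-coupling reading and every floor but NOT the
compact-window reading (`m3_not_uvCompact`: the window [2^{-N-1}, γ] contains the constant runs at the code values c_K/2^N,
K ∈ ℕ, where codeExp = K + 1 is unbounded); M4 = `toy gsConst (fun x => 1/x)` has the compact-window reading, the
bare-coupling reading and every floor but NOT the run-uniform reading `B16.UVBound01` (`m4_not_uvBound01`: 1/g₀ is
unbounded on ]0, γ]).  And the floor-free arrow C ⇒ R is a THEOREM for every construction (`perRun_of_compact`, §4.1: a run
visits finitely many couplings, all ≥ min_{k ≤ K} g_k > 0; the floor hypothesis of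
`B16B10Shape.uvPerRun_of_uvCompact_floor` is needed for the arrow C ⇒ B, not for C ⇒ R).
(c) THE PIN IS STRICTLY ABOVE THE PER-RUN READING (§4.4).  Model M6 (`m6`: constant couplings, densities ρ_k ≡ exp k indexed
by the STEP, not by the coupling value) satisfies χ_k ≥ 0, `Thm1Printed`, `UVBound01PerRun` (E₊ = K per run) and every
floor, but NOT `Cor3_250` (`m6_not_cor3`: e₊(γ) would have to exceed every K) — `B16.uvBound01PerRun_of_endStatementBPrinted`
is strict (`perRun_not_implies_cor3`, `perRun_floor_not_implies_pin`): [III] Cor. 3's dependence FUNCTIONS e±(g_k), chosen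
before the run, carry cross-run content that (0.1)-per-run does not.

THE COMPLETE PICTURE ON THE CARRIER (U = `B16.UVBound01`, C = `B16B10Shape.UVBound01Compact`, B = `B16.UVBound01PerBare`,
R = `B16.UVBound01PerRun`, pin = `B16.EndStatementBPrinted`; χ_k ≥ 0 granted; floor(β₀) = for every γ > 0, every run of
the ]0, γ]-family and every k ≤ K, g_0 ≤ (1+β₀) g_k).  PROVED ARROWS (by name): U ⇒ C (`B16B10Shape.uvCompact_of_uvBound01`),
U ⇒ B (`B16.uvBound01PerBare_of_uvBound01`), B ⇒ R (`B16.uvBound01PerRun_of_perBare`), C ⇒ R (`perRun_of_compact`, here),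
C ∧ floor(β₀), β₀ ≥ 0 ⇒ B (`B16B10Shape.uvPerBare_of_uvCompact_floor`), pin ⇒ R (`B16.uvBound01PerRun_of_endStatementBPrinted`).
REFUTED ARROWS (kernel counter-models; the pin holds in M1–M5): C ⇏ B (M1, §2 — M1 violates every floor), C ∧ B ∧ floor ⇏ U
(M4), B ∧ floor ⇏ C (M3), R ∧ floor(β₀) ⇏ B for every β₀ > 0 (M5(β₀); β₀ = 1: M2, §3), R ∧ Thm 1 ∧ floor ⇏ pin (M6).
HENCE, as predicates on the carrier: WITHOUT the floor the four readings form the diamond U ⊊ C ⊊ R, U ⊊ B ⊊ R with C and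
B INCOMPARABLE (M1: C ∧ ¬B; M3: B ∧ ¬C); WITH the floor (β₀ ≥ 0 in the positive arrow, every β₀ > 0 in the counter-models)
they form the STRICT CHAIN U ⊊ C ⊊ B ⊊ R (strictness witnessed by M4, M3, M5(β₀)).  In words: the printed clause of (0.1)
*"with the constants E₋, E₊ independent of k, T_η, U_k"* ([Balaban1989LargeFieldII] p. 356, quoted in `B16.UV01With`) has
(at least) four pairwise inequivalent typings differing only in WHERE E± is quantified relative to the run and to the
coupling; print has the one sentence; the cell's pin (B) reads it through [III] Cor. 3; the typings are recorded, not
adjudicated (cell DIVERGENCE D-r2.14).  HONEST LABELLING as in the header: toy inhabitants of the statement-level carrier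
only, nothing printed asserted or used; (B) = `B16.EndStatementBPrinted`, CONDITIONAL on g_k ∈ ]0, γ], untouched.
value = kernel bookkeeping about the typed readings, NOT summit progress. -/

/-! ### §4.1 The arrow C ⇒ R needs no floor; M2's couplings strictly decrease -/

/-- **Compact-window reading ⇒ per-run reading, for EVERY construction and WITHOUT the (2.6)-floor**: a run of the
]0, γ]-family visits the finitely many couplings g_0, …, g_K, all in the window [min_{k ≤ K} g_k, γ] whose left end is
positive and attained (`Finset.exists_mem_eq_inf'`), and `UVBound01Compact` supplies E± on that window.  (So the floor
hypothesis of `B16B10Shape.uvPerRun_of_uvCompact_floor` serves the arrow C ⇒ B only, cf. `compact_not_implies_perBare`.) [folklore] -/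
theorem perRun_of_compact (C : B16.Construction) (h : B16B10Shape.UVBound01Compact C) : B16.UVBound01PerRun C := by
  obtain ⟨γ, hγ, hwin⟩ := h
  refine ⟨γ, hγ, fun P hP => ?_⟩
  have hne : (Finset.range (P.K + 1)).Nonempty := ⟨0, Finset.mem_range.mpr (Nat.succ_pos _)⟩
  obtain ⟨k₀, hk₀mem, hk₀⟩ := Finset.exists_mem_eq_inf' hne (fun k => (C P).flow.g k)
  have hk₀K : k₀ ≤ P.K := Nat.le_of_lt_succ (Finset.mem_range.mp hk₀mem)
  have hpos : 0 < (Finset.range (P.K + 1)).inf' hne (fun k => (C P).flow.g k) := by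
    rw [hk₀]
    exact (hP k₀ hk₀K).1
  have hleγ : (Finset.range (P.K + 1)).inf' hne (fun k => (C P).flow.g k) ≤ γ := by
    rw [hk₀]
    exact (hP k₀ hk₀K).2
  obtain ⟨Em, Ep, hW⟩ := hwin _ hpos hleγ
  exact ⟨Em, Ep, fun k hk V => hW P hP k hk (Finset.inf'_le _ (Finset.mem_range.mpr (Nat.lt_succ_of_le hk))) V⟩

/-- M2 (§3): the couplings are STRICTLY decreasing along every run with g₀ > 0 (cell GAPS C-pv06-18 micro-remark R2;
`m2_antitone` is the weak form under g₀ ≥ 0). [folklore] -/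
theorem m2_strictAnti (P : B12.RunParams) (hg : 0 < P.g0) : StrictAnti (fun k => (m2 P).flow.g k) := by
  intro a b hab
  show P.g0 * cM2 b < P.g0 * cM2 a
  exact mul_lt_mul_of_pos_left (cM2_strictAnti hab) hg

/-- M1 (§2) does not satisfy the run-uniform reading either (`B16.uvBound01PerBare_of_uvBound01` contrapositively). [folklore] -/
theorem m1_not_uvBound01 : ¬ B16.UVBound01 m1 :=
  fun h => m1_not_perBare (B16.uvBound01PerBare_of_uvBound01 m1 h)

/-- **The compact-window reading (pin + χ_k ≥ 0 granted; M1's witness locally bounded and continuous on ]0, γ]) does not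
imply the run-uniform reading `B16.UVBound01`**: M1.  (With every floor as well: M4, `compact_perBare_floor_not_implies_uvBound01`.) [folklore] -/
theorem compact_not_implies_uvBound01 :
    ¬ ∀ C : B16.Construction, B16.SignConventions C → B16.EndStatementBPrinted C →
      B16B10Shape.UVBound01Compact C → B16.UVBound01 C :=
  fun h => m1_not_uvBound01 (h m1 m1_sign m1_pin m1_uvCompact)

/-! ### §4.2 Constant flows: models M3 (bare coupling and floor, no window) and M4 (window, bare coupling and floor, no
run-uniform E±) -/

/-- Constant coupling scheme: `g_k = g₀` at every step of the run `(K, m, g₀)`. [folklore] -/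
def gsConst (P : B12.RunParams) (_k : ℕ) : ℝ := P.g0

/-- `gsConst P k = g₀`. [folklore] -/
@[simp] theorem gsConst_apply (P : B12.RunParams) (k : ℕ) : gsConst P k = P.g0 := rfl

/-- A constant run `(K, m, g₀)` with `0 < g₀ ≤ γ` lies in the ]0, γ]-family, for any exponent function. [folklore] -/
theorem const_inInterval (e : ℝ → ℝ) (γ : ℝ) (K m : ℕ) (g₀ : ℝ) (hg₀ : 0 < g₀) (hle : g₀ ≤ γ) :
    ((toy gsConst e) ⟨K, m, g₀⟩).flow.InInterval γ K := by
  intro k _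
  show 0 < g₀ ∧ g₀ ≤ γ
  exact ⟨hg₀, hle⟩

/-- A constant flow satisfies the (2.6)-floor `g_0 ≤ (1+β₀) g_k` for every β₀ ≥ 0, along every run of every
]0, γ]-family. [folklore] -/
theorem const_floor (e : ℝ → ℝ) (β₀ : ℝ) (hβ₀ : 0 ≤ β₀) (γ : ℝ) :
    ∀ P : B12.RunParams, ((toy gsConst e) P).flow.InInterval γ P.K →
      ∀ k, k ≤ P.K → ((toy gsConst e) P).flow.g 0 ≤ (1 + β₀) * ((toy gsConst e) P).flow.g k := by
  intro P hP k _
  have h0 : 0 < P.g0 := (hP 0 (Nat.zero_le _)).1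
  show P.g0 ≤ (1 + β₀) * P.g0
  nlinarith

/-- On a constant flow the bare-coupling reading holds for EVERY exponent function `e` (E₋ = 0, E₊ = e g₀ — a run from g₀
visits only the coupling g₀), at γ = 1 (any γ would do). [folklore] -/
theorem const_perBare (e : ℝ → ℝ) : B16.UVBound01PerBare (toy gsConst e) := by
  refine ⟨1, one_pos, fun g₀ _ _ => ⟨0, e g₀, fun P _ h0 k _ V => ?_⟩⟩
  have hg : P.g0 = g₀ := h0
  exact (toy_uvIneq_iff gsConst e P k V 0 (e g₀)).mpr (le_of_eq (by rw [gsConst_apply, hg]))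

/-- Model M3: constant couplings, `ρ_k ≡ exp codeExp(g_k)` (the exponent function of M2, §3). [folklore] -/
def m3 : B16.Construction := toy gsConst codeExp

/-- M3: sign convention. [folklore] -/
theorem m3_sign : B16.SignConventions m3 := toy_sign _ _

/-- M3: the pinned end statement (B) holds. [folklore] -/
theorem m3_pin : B16.EndStatementBPrinted m3 := toy_pin _ _

/-- M3: (0.1) per run holds. [folklore] -/
theorem m3_perRun : B16.UVBound01PerRun m3 := toy_perRun _ _

/-- M3: the bare-coupling reading HOLDS. [folklore] -/
theorem m3_perBare : B16.UVBound01PerBare m3 := const_perBare _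

/-- M3: the (2.6)-floor holds for every β₀ ≥ 0 at every γ. [folklore] -/
theorem m3_floor (β₀ : ℝ) (hβ₀ : 0 ≤ β₀) (γ : ℝ) : ∀ P : B12.RunParams, (m3 P).flow.InInterval γ P.K →
    ∀ k, k ≤ P.K → (m3 P).flow.g 0 ≤ (1 + β₀) * (m3 P).flow.g k :=
  const_floor _ β₀ hβ₀ γ

/-- M3 does NOT satisfy the compact-window reading: at any γ > 0 pick a dyadic scale 2^{-N} ≤ γ and the window
[2^{-N-1}, γ]; the constant runs (0, 0, g₀) with `g₀ = code N K = c_K/2^N ∈ ]2^{-N-1}, 2^{-N}]`, K ∈ ℕ, lie in it and have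
`codeExp g₀ = K + 1`, unbounded (take K = ⌈E₊⌉₊). [folklore] -/
theorem m3_not_uvCompact : ¬ B16B10Shape.UVBound01Compact m3 := by
  rintro ⟨γ, hγ, hwin⟩
  obtain ⟨N, hN⟩ := exists_dyadic_le γ hγ
  have hNpos := two_pow_pos' N
  have hmin : (0 : ℝ) < 1 / (2 * (2 : ℝ) ^ N) := by positivity
  have hminle : 1 / (2 * (2 : ℝ) ^ N) ≤ γ :=
    le_trans (one_div_le_one_div_of_le hNpos (by linarith)) hN
  obtain ⟨Em, Ep, hW⟩ := hwin _ hmin hminle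
  have hb := code_bounds N ⌈Ep⌉₊
  have hcpos : 0 < code N ⌈Ep⌉₊ := lt_trans hmin hb.1
  have hcle : code N ⌈Ep⌉₊ ≤ γ := le_trans hb.2 hN
  have hineq := (toy_uvIneq_iff gsConst codeExp ⟨0, 0, code N ⌈Ep⌉₊⟩ 0 () Em Ep).mp
    (hW ⟨0, 0, code N ⌈Ep⌉₊⟩ (const_inInterval codeExp γ 0 0 _ hcpos hcle) 0 le_rfl hb.1.le ())
  change codeExp (code N ⌈Ep⌉₊) ≤ Ep at hineq
  rw [codeExp_code] at hineq
  have : Ep < (⌈Ep⌉₊ : ℝ) + 1 := lt_of_le_of_lt (Nat.le_ceil _) (lt_add_one _)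
  linarith

/-- Nor the run-uniform reading (`B16B10Shape.uvCompact_of_uvBound01` contrapositively). [folklore] -/
theorem m3_not_uvBound01 : ¬ B16.UVBound01 m3 :=
  fun h => m3_not_uvCompact (B16B10Shape.uvCompact_of_uvBound01 m3 h)

/-- **The bare-coupling reading does not imply the compact-window reading** (pin + χ_k ≥ 0 granted): M3.  With
`compact_not_implies_perBare` (§2, M1): WITHOUT the (2.6)-floor the compact-window and the bare-coupling readings are
INCOMPARABLE on the carrier. [folklore] -/
theorem perBare_not_implies_compact :
    ¬ ∀ C : B16.Construction, B16.SignConventions C → B16.EndStatementBPrinted C →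
      B16.UVBound01PerBare C → B16B10Shape.UVBound01Compact C :=
  fun h => m3_not_uvCompact (h m3 m3_sign m3_pin m3_perBare)

/-- … and not even WITH the (2.6)-floor (any β₀ ≥ 0, demanded at every γ): under the floor `C ∧ floor ⇒ B`
(`B16B10Shape.uvPerBare_of_uvCompact_floor`) is STRICT, C ⊊ B. [folklore] -/
theorem perBare_floor_not_implies_compact (β₀ : ℝ) (hβ₀ : 0 ≤ β₀) :
    ¬ ∀ C : B16.Construction, B16.SignConventions C → B16.EndStatementBPrinted C →
      (∀ γ : ℝ, 0 < γ → ∀ P : B12.RunParams, (C P).flow.InInterval γ P.K →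
        ∀ k, k ≤ P.K → (C P).flow.g 0 ≤ (1 + β₀) * (C P).flow.g k) →
      B16.UVBound01PerBare C → B16B10Shape.UVBound01Compact C :=
  fun h => m3_not_uvCompact (h m3 m3_sign m3_pin (fun γ _ => m3_floor β₀ hβ₀ γ) m3_perBare)

/-- Model M4: constant couplings, `ρ_k ≡ exp(1/g_k)` (the exponent function of M1, §2). [folklore] -/
def m4 : B16.Construction := toy gsConst (fun x => 1 / x)

/-- M4: sign convention. [folklore] -/
theorem m4_sign : B16.SignConventions m4 := toy_sign _ _

/-- M4: [III] Cor. 3's form at every γ with `e₋ ≡ 0`, `e₊(x) = 1/x` (locally bounded, continuous on ]0, γ]). [folklore] -/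
theorem m4_cor3With (γ : ℝ) : B16.Cor3With m4 γ (fun _ => 0) (fun x => 1 / x) := toy_cor3With _ _ γ

/-- M4: the pinned end statement (B) holds. [folklore] -/
theorem m4_pin : B16.EndStatementBPrinted m4 := toy_pin _ _

/-- M4: (0.1) per run holds. [folklore] -/
theorem m4_perRun : B16.UVBound01PerRun m4 := toy_perRun _ _

/-- M4: the bare-coupling reading HOLDS. [folklore] -/
theorem m4_perBare : B16.UVBound01PerBare m4 := const_perBare _

/-- M4: the (2.6)-floor holds for every β₀ ≥ 0 at every γ. [folklore] -/
theorem m4_floor (β₀ : ℝ) (hβ₀ : 0 ≤ β₀) (γ : ℝ) : ∀ P : B12.RunParams, (m4 P).flow.InInterval γ P.K →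
    ∀ k, k ≤ P.K → (m4 P).flow.g 0 ≤ (1 + β₀) * (m4 P).flow.g k :=
  const_floor _ β₀ hβ₀ γ

/-- M4: the window statement at every γ and every `g_min > 0` (E₋ = 0, E₊ = 1/g_min), by `B16B10Shape.uvWindow_of_cor3`. [folklore] -/
theorem m4_window (γ gmin : ℝ) (hmin : 0 < gmin) : B16B10Shape.UV01Window m4 γ gmin 0 (1 / gmin) :=
  B16B10Shape.uvWindow_of_cor3 m4 γ gmin (fun _ => 0) (fun x => 1 / x) 0 (1 / gmin) m4_sign (m4_cor3With γ)
    (fun _ _ _ => le_rfl) (fun _ hx _ => one_div_le_one_div_of_le hmin hx)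

/-- M4: the compact-window reading HOLDS. [folklore] -/
theorem m4_uvCompact : B16B10Shape.UVBound01Compact m4 :=
  ⟨1, one_pos, fun gmin hmin _ => ⟨0, 1 / gmin, m4_window 1 gmin hmin⟩⟩

/-- M4 does NOT satisfy the run-uniform reading `B16.UVBound01`: at any γ and any proposed E₊ the constant run (0, 0, g₀)
with `g₀ = γ/(⌈E₊ γ⌉₊ + 1) ∈ ]0, γ]` has `1/g₀ > E₊`. [folklore] -/
theorem m4_not_uvBound01 : ¬ B16.UVBound01 m4 := by
  rintro ⟨γ, hγ, Em, Ep, h⟩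
  have hKpos : (0 : ℝ) < (⌈Ep * γ⌉₊ : ℝ) + 1 := by positivity
  have hg₀ : 0 < γ / ((⌈Ep * γ⌉₊ : ℝ) + 1) := div_pos hγ hKpos
  have hg₀le : γ / ((⌈Ep * γ⌉₊ : ℝ) + 1) ≤ γ := div_le_self hγ.le (by linarith)
  have hineq := (toy_uvIneq_iff gsConst (fun x => 1 / x) ⟨0, 0, γ / ((⌈Ep * γ⌉₊ : ℝ) + 1)⟩ 0 () Em Ep).mp
    (h ⟨0, 0, γ / ((⌈Ep * γ⌉₊ : ℝ) + 1)⟩ (const_inInterval (fun x => 1 / x) γ 0 0 _ hg₀ hg₀le) 0 le_rfl ())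
  change 1 / (γ / ((⌈Ep * γ⌉₊ : ℝ) + 1)) ≤ Ep at hineq
  rw [one_div_div, div_le_iff₀ hγ] at hineq
  have hK : Ep * γ < (⌈Ep * γ⌉₊ : ℝ) + 1 := lt_of_le_of_lt (Nat.le_ceil _) (lt_add_one _)
  linarith

/-- **The compact-window reading, even together with the bare-coupling reading and the (2.6)-floor (any β₀ ≥ 0, at every γ;
pin + χ_k ≥ 0 granted), does not imply the run-uniform reading `B16.UVBound01`**: M4 — the first arrow U ⇒ C of the chain
is strict under the floor. [folklore] -/
theorem compact_perBare_floor_not_implies_uvBound01 (β₀ : ℝ) (hβ₀ : 0 ≤ β₀) :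
    ¬ ∀ C : B16.Construction, B16.SignConventions C → B16.EndStatementBPrinted C →
      (∀ γ : ℝ, 0 < γ → ∀ P : B12.RunParams, (C P).flow.InInterval γ P.K →
        ∀ k, k ≤ P.K → (C P).flow.g 0 ≤ (1 + β₀) * (C P).flow.g k) →
      B16B10Shape.UVBound01Compact C → B16.UVBound01PerBare C → B16.UVBound01 C :=
  fun h => m4_not_uvBound01 (h m4 m4_sign m4_pin (fun γ _ => m4_floor β₀ hβ₀ γ) m4_uvCompact m4_perBare)

/-! ### §4.3 Models M5(β₀) — pin + the (2.6)-floor with EVERY parameter β₀ > 0, NO local boundedness -/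

/-- The floor ratio `λ(β₀) = 1/(1+β₀)`. [folklore] -/
def lam (β₀ : ℝ) : ℝ := 1 / (1 + β₀)

/-- `0 < λ`. [folklore] -/
theorem lam_pos (β₀ : ℝ) (hβ₀ : 0 < β₀) : 0 < lam β₀ := by
  unfold lam
  exact div_pos one_pos (by linarith)

/-- `λ < 1`. [folklore] -/
theorem lam_lt_one (β₀ : ℝ) (hβ₀ : 0 < β₀) : lam β₀ < 1 := by
  unfold lam
  rw [div_lt_one (by linarith)]
  linarith

/-- `(1+β₀) λ = 1`. [folklore] -/
theorem one_add_mul_lam (β₀ : ℝ) (hβ₀ : 0 < β₀) : (1 + β₀) * lam β₀ = 1 := by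
  unfold lam
  exact mul_one_div_cancel (ne_of_gt (by linarith))

/-- The profile `c_k(β₀) = λ + (1 − λ)/(k+1)`: `c_0 = 1`, `λ < c_k ≤ 1`, strictly decreasing. [folklore] -/
def cM5 (β₀ : ℝ) (k : ℕ) : ℝ := lam β₀ + (1 - lam β₀) / ((k : ℝ) + 1)

/-- `c_0 = 1`. [folklore] -/
theorem cM5_zero (β₀ : ℝ) : cM5 β₀ 0 = 1 := by
  simp [cM5]

/-- `λ < c_k`. [folklore] -/
theorem lam_lt_cM5 (β₀ : ℝ) (hβ₀ : 0 < β₀) (k : ℕ) : lam β₀ < cM5 β₀ k := by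
  unfold cM5
  have h1 : 0 < 1 - lam β₀ := by linarith [lam_lt_one β₀ hβ₀]
  have : (0 : ℝ) < (1 - lam β₀) / ((k : ℝ) + 1) := div_pos h1 (by positivity)
  linarith

/-- `c_k ≤ 1`. [folklore] -/
theorem cM5_le_one (β₀ : ℝ) (hβ₀ : 0 < β₀) (k : ℕ) : cM5 β₀ k ≤ 1 := by
  unfold cM5
  have h1 : 0 ≤ 1 - lam β₀ := by linarith [lam_lt_one β₀ hβ₀]
  have hk : (1 : ℝ) ≤ (k : ℝ) + 1 := by
    have : (0 : ℝ) ≤ k := Nat.cast_nonneg k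
    linarith
  have : (1 - lam β₀) / ((k : ℝ) + 1) ≤ 1 - lam β₀ := div_le_self h1 hk
  linarith

/-- `0 < c_k`. [folklore] -/
theorem cM5_pos (β₀ : ℝ) (hβ₀ : 0 < β₀) (k : ℕ) : 0 < cM5 β₀ k :=
  lt_trans (lam_pos β₀ hβ₀) (lam_lt_cM5 β₀ hβ₀ k)

/-- `c(β₀)` is strictly decreasing. [folklore] -/
theorem cM5_strictAnti (β₀ : ℝ) (hβ₀ : 0 < β₀) : StrictAnti (cM5 β₀) := by
  intro a b hab
  show lam β₀ + (1 - lam β₀) / ((b : ℝ) + 1) < lam β₀ + (1 - lam β₀) / ((a : ℝ) + 1)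
  have h1 : 0 < 1 - lam β₀ := by linarith [lam_lt_one β₀ hβ₀]
  have ha : (0 : ℝ) < (a : ℝ) + 1 := by positivity
  have hab' : (a : ℝ) + 1 < (b : ℝ) + 1 := by
    have : (a : ℝ) < b := Nat.cast_lt.mpr hab
    linarith
  have := div_lt_div_of_pos_left h1 ha hab'
  linarith

/-- `c(β₀)` is injective. [folklore] -/
theorem cM5_injective (β₀ : ℝ) (hβ₀ : 0 < β₀) : Function.Injective (cM5 β₀) := (cM5_strictAnti β₀ hβ₀).injective

/-- Consistency with §3: M2's profile `cM2` is the case β₀ = 1 (λ = 1/2). [folklore] -/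
theorem cM5_one : cM5 1 = cM2 := by
  funext k
  rw [cM2_eq]
  unfold cM5 lam
  have hk : (k : ℝ) + 1 ≠ 0 := by positivity
  have hk2 : 2 * (k : ℝ) + 2 ≠ 0 := by positivity
  field_simp
  ring

/-- M5(β₀)'s coupling scheme: `g_k = g₀·c_k(β₀)` for the run `(K, m, g₀)`; `g_0 = g₀`. [folklore] -/
def gsM5 (β₀ : ℝ) (P : B12.RunParams) (k : ℕ) : ℝ := P.g0 * cM5 β₀ k

/-- M5(β₀)'s bare coupling is `g₀`. [folklore] -/
theorem gsM5_zero (β₀ : ℝ) (P : B12.RunParams) : gsM5 β₀ P 0 = P.g0 := by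
  simp [gsM5, cM5_zero]

/-- The code `(N, k) ↦ λ^N c_k(β₀)`. [folklore] -/
def code5 (β₀ : ℝ) (N k : ℕ) : ℝ := lam β₀ ^ N * cM5 β₀ k

/-- `λ^{N+1} < code5 N k ≤ λ^N`. [folklore] -/
theorem code5_bounds (β₀ : ℝ) (hβ₀ : 0 < β₀) (N k : ℕ) :
    lam β₀ ^ (N + 1) < code5 β₀ N k ∧ code5 β₀ N k ≤ lam β₀ ^ N := by
  have hl := pow_pos (lam_pos β₀ hβ₀) N
  refine ⟨?_, ?_⟩
  · rw [pow_succ]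
    exact mul_lt_mul_of_pos_left (lam_lt_cM5 β₀ hβ₀ k) hl
  · exact mul_le_of_le_one_right hl.le (cM5_le_one β₀ hβ₀ k)

/-- The code is injective: the scale N is read off from `λ^{N+1} < x ≤ λ^N` (λ < 1), then k from `c(β₀)` injective. [folklore] -/
theorem code5_inj (β₀ : ℝ) (hβ₀ : 0 < β₀) {N k N' k' : ℕ} (h : code5 β₀ N k = code5 β₀ N' k') : N = N' ∧ k = k' := by
  have hb := code5_bounds β₀ hβ₀ N k
  have hb' := code5_bounds β₀ hβ₀ N' k'
  have hl0 := (lam_pos β₀ hβ₀).le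
  have hl1 := (lam_lt_one β₀ hβ₀).le
  have key : ∀ {M M' : ℕ} {x : ℝ}, lam β₀ ^ (M + 1) < x → x ≤ lam β₀ ^ M' → ¬ M < M' := by
    intro M M' x hlow hup hlt
    have hpow : lam β₀ ^ M' ≤ lam β₀ ^ (M + 1) := pow_le_pow_of_le_one hl0 hl1 hlt
    linarith
  have hNN : N = N' := by
    rcases lt_trichotomy N N' with hlt | heq | hgt
    · exact absurd hlt (key hb.1 (h ▸ hb'.2))
    · exact heq
    · exact absurd hgt (key hb'.1 (h.symm ▸ hb.2))
  subst hNN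
  refine ⟨rfl, cM5_injective β₀ hβ₀ ?_⟩
  have h' : lam β₀ ^ N * cM5 β₀ k = lam β₀ ^ N * cM5 β₀ k' := h
  exact mul_left_cancel₀ (pow_pos (lam_pos β₀ hβ₀) N).ne' h'

open Classical in
/-- ONE exponent function for M5(β₀), chosen before every run: `k + 1` on the code value `λ^N c_k(β₀)`, 0 elsewhere. [folklore] -/
def codeExp5 (β₀ : ℝ) (x : ℝ) : ℝ :=
  if h : ∃ p : ℕ × ℕ, x = code5 β₀ p.1 p.2 then ((Classical.choose h).2 : ℝ) + 1 else 0

/-- `codeExp5 β₀ (code5 β₀ N k) = k + 1`. [folklore] -/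
theorem codeExp5_code (β₀ : ℝ) (hβ₀ : 0 < β₀) (N k : ℕ) : codeExp5 β₀ (code5 β₀ N k) = (k : ℝ) + 1 := by
  have h : ∃ p : ℕ × ℕ, code5 β₀ N k = code5 β₀ p.1 p.2 := ⟨(N, k), rfl⟩
  rw [codeExp5, dif_pos h]
  obtain ⟨-, hk⟩ := code5_inj β₀ hβ₀ (Classical.choose_spec h)
  rw [← hk]

/-- Model M5(β₀): `toy (gsM5 β₀) (codeExp5 β₀)`. [folklore] -/
def m5 (β₀ : ℝ) : B16.Construction := toy (gsM5 β₀) (codeExp5 β₀)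

/-- A run `(K, m, g₀)` with `0 < g₀ ≤ γ` lies in the ]0, γ]-family of M5(β₀). [folklore] -/
theorem m5_inInterval (β₀ : ℝ) (hβ₀ : 0 < β₀) (γ : ℝ) (K m : ℕ) (g₀ : ℝ) (hg₀ : 0 < g₀) (hle : g₀ ≤ γ) :
    (m5 β₀ ⟨K, m, g₀⟩).flow.InInterval γ K := by
  intro k _
  refine ⟨?_, ?_⟩
  · show 0 < g₀ * cM5 β₀ k
    exact mul_pos hg₀ (cM5_pos β₀ hβ₀ k)
  · show g₀ * cM5 β₀ k ≤ γ
    exact le_trans (mul_le_of_le_one_right hg₀.le (cM5_le_one β₀ hβ₀ k)) hle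

/-- M5(β₀): sign convention. [folklore] -/
theorem m5_sign (β₀ : ℝ) : B16.SignConventions (m5 β₀) := toy_sign _ _

/-- M5(β₀): [III] Cor. 3's form at every γ with `e₋ ≡ 0`, `e₊ = codeExp5 β₀`. [folklore] -/
theorem m5_cor3With (β₀ γ : ℝ) : B16.Cor3With (m5 β₀) γ (fun _ => 0) (codeExp5 β₀) := toy_cor3With _ _ γ

/-- M5(β₀): the pinned end statement (B) holds. [folklore] -/
theorem m5_pin (β₀ : ℝ) : B16.EndStatementBPrinted (m5 β₀) := toy_pin _ _

/-- M5(β₀): (0.1) per run holds. [folklore] -/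
theorem m5_perRun (β₀ : ℝ) : B16.UVBound01PerRun (m5 β₀) := toy_perRun _ _

/-- M5(β₀): the couplings are strictly decreasing along every run with g₀ > 0. [folklore] -/
theorem m5_strictAnti (β₀ : ℝ) (hβ₀ : 0 < β₀) (P : B12.RunParams) (hg : 0 < P.g0) :
    StrictAnti (fun k => (m5 β₀ P).flow.g k) := by
  intro a b hab
  show P.g0 * cM5 β₀ b < P.g0 * cM5 β₀ a
  exact mul_lt_mul_of_pos_left (cM5_strictAnti β₀ hβ₀ hab) hg

/-- M5(β₀) SATISFIES the (2.6)-floor WITH THE GIVEN β₀ — `g_0 ≤ (1+β₀) g_k` along every run of the ]0, γ]-family, at every γ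
(because (1+β₀) c_k > (1+β₀) λ = 1); the FORM of (2.6)'s last member at m = 0, nothing printed asserted. [folklore] -/
theorem m5_floor (β₀ : ℝ) (hβ₀ : 0 < β₀) (γ : ℝ) : ∀ P : B12.RunParams, (m5 β₀ P).flow.InInterval γ P.K →
    ∀ k, k ≤ P.K → (m5 β₀ P).flow.g 0 ≤ (1 + β₀) * (m5 β₀ P).flow.g k := by
  intro P hP k _
  have h0 : 0 < P.g0 * cM5 β₀ 0 := (hP 0 (Nat.zero_le _)).1
  rw [cM5_zero, mul_one] at h0
  show P.g0 * cM5 β₀ 0 ≤ (1 + β₀) * (P.g0 * cM5 β₀ k)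
  rw [cM5_zero, mul_one]
  have h1 : 1 < (1 + β₀) * cM5 β₀ k := by
    have := mul_lt_mul_of_pos_left (lam_lt_cM5 β₀ hβ₀ k) (by linarith : (0 : ℝ) < 1 + β₀)
    rwa [one_add_mul_lam β₀ hβ₀] at this
  nlinarith [mul_lt_mul_of_pos_left h1 h0]

/-- Below every γ > 0 there is a scale `λ^N ≤ γ` (λ < 1). [folklore] -/
theorem exists_lam_pow_le (β₀ : ℝ) (hβ₀ : 0 < β₀) (γ : ℝ) (hγ : 0 < γ) : ∃ N : ℕ, lam β₀ ^ N ≤ γ := by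
  obtain ⟨N, hN⟩ := exists_pow_lt_of_lt_one hγ (lam_lt_one β₀ hβ₀)
  exact ⟨N, hN.le⟩

/-- M5(β₀): the bare-coupling reading FAILS — from g₀ = λ^N ≤ γ the run with K = ⌈E₊⌉₊ steps reaches the coupling
`code5 N K = λ^N c_K ∈ ]λ^{N+1}, λ^N]`, where `codeExp5 = K + 1 > E₊`. [folklore] -/
theorem m5_not_perBare (β₀ : ℝ) (hβ₀ : 0 < β₀) : ¬ B16.UVBound01PerBare (m5 β₀) := by
  refine toy_not_perBare (gsM5 β₀) (codeExp5 β₀) fun γ hγ => ?_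
  obtain ⟨N, hN⟩ := exists_lam_pow_le β₀ hβ₀ γ hγ
  have hg₀ : 0 < lam β₀ ^ N := pow_pos (lam_pos β₀ hβ₀) N
  refine ⟨lam β₀ ^ N, hg₀, hN, fun Ep => ?_⟩
  refine ⟨⟨⌈Ep⌉₊, 0, lam β₀ ^ N⟩, m5_inInterval β₀ hβ₀ γ _ 0 _ hg₀ hN, gsM5_zero β₀ _, ⌈Ep⌉₊, le_rfl, ?_⟩
  have hcode : gsM5 β₀ ⟨⌈Ep⌉₊, 0, lam β₀ ^ N⟩ ⌈Ep⌉₊ = code5 β₀ N ⌈Ep⌉₊ := rfl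
  rw [hcode, codeExp5_code β₀ hβ₀]
  exact lt_of_le_of_lt (Nat.le_ceil _) (lt_add_one _)

/-- **For EVERY β₀ > 0: pin + χ_k ≥ 0 + the (2.6)-floor with parameter β₀ (at every γ) do NOT imply the bare-coupling
reading** — M5(β₀); §3's `pin_floor_not_implies_perBare` is the instance β₀ = 1 with β₀ quantified under the negation.
However small the printed β₀, the floor does not replace local boundedness of e±. [folklore] -/
theorem pin_floor_not_implies_perBare_sharp (β₀ : ℝ) (hβ₀ : 0 < β₀) :
    ¬ ∀ C : B16.Construction, B16.SignConventions C → B16.EndStatementBPrinted C →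
      (∀ γ : ℝ, 0 < γ → ∀ P : B12.RunParams, (C P).flow.InInterval γ P.K →
        ∀ k, k ≤ P.K → (C P).flow.g 0 ≤ (1 + β₀) * (C P).flow.g k) →
      B16.UVBound01PerBare C :=
  fun h => m5_not_perBare β₀ hβ₀ (h (m5 β₀) (m5_sign β₀) (m5_pin β₀) fun γ _ => m5_floor β₀ hβ₀ γ)

/-- **For EVERY β₀ > 0: the per-run reading + pin + χ_k ≥ 0 + floor(β₀) do NOT imply the bare-coupling reading** — the last
arrow B ⇒ R of the chain is strict under the floor (M5(β₀)); `perRun_not_implies_perBare` (§3) is the floor-free form. [folklore] -/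
theorem perRun_floor_not_implies_perBare (β₀ : ℝ) (hβ₀ : 0 < β₀) :
    ¬ ∀ C : B16.Construction, B16.SignConventions C → B16.EndStatementBPrinted C → B16.UVBound01PerRun C →
      (∀ γ : ℝ, 0 < γ → ∀ P : B12.RunParams, (C P).flow.InInterval γ P.K →
        ∀ k, k ≤ P.K → (C P).flow.g 0 ≤ (1 + β₀) * (C P).flow.g k) →
      B16.UVBound01PerBare C :=
  fun h => m5_not_perBare β₀ hβ₀
    (h (m5 β₀) (m5_sign β₀) (m5_pin β₀) (m5_perRun β₀) fun γ _ => m5_floor β₀ hβ₀ γ)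

/-- In M5(β₀) NO [III]-Cor.-3 witness (e₋, e₊), at any γ > 0, is bounded above on every coupling window [g_min, γ]
(`B16.uvBound01PerBare_of_cor3_floor` contrapositively, floor parameter β₀). [folklore] -/
theorem m5_no_locally_bounded_witness (β₀ : ℝ) (hβ₀ : 0 < β₀) (γ : ℝ) (hγ : 0 < γ) (em ep : ℝ → ℝ)
    (hcor : B16.Cor3With (m5 β₀) γ em ep) :
    ¬ ∀ gmin : ℝ, 0 < gmin → gmin ≤ γ →
      (∃ Em : ℝ, ∀ x, gmin ≤ x → x ≤ γ → em x ≤ Em) ∧ (∃ Ep : ℝ, ∀ x, gmin ≤ x → x ≤ γ → ep x ≤ Ep) :=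
  fun hbdd => m5_not_perBare β₀ hβ₀
    (B16.uvBound01PerBare_of_cor3_floor (m5 β₀) (m5_sign β₀) γ hγ em ep hcor hbdd β₀ hβ₀.le (m5_floor β₀ hβ₀ γ))

/-- M5(β₀) does NOT satisfy the compact-window reading — by the sibling's by-name bridge
`B16B10Shape.uvPerBare_of_uvCompact_floor` (v2.2 §5) read contrapositively with floor parameter β₀. [folklore] -/
theorem m5_not_uvCompact (β₀ : ℝ) (hβ₀ : 0 < β₀) : ¬ B16B10Shape.UVBound01Compact (m5 β₀) :=
  fun h => m5_not_perBare β₀ hβ₀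
    (B16B10Shape.uvPerBare_of_uvCompact_floor (m5 β₀) β₀ hβ₀.le h fun γ _ => m5_floor β₀ hβ₀ γ)

/-! ### §4.4 Model M6 — step-indexed densities: the pin is strictly above the per-run reading -/

/-- M6's run data for bare coupling g₀: constant couplings, β ≡ 0, ONE configuration and ONE site per step, χ ≡ 0, every
abstract predicate `True`, and densities `ρ_k ≡ exp k` indexed by the STEP (not a function of the coupling value).  A
statement-level inhabitant only. [folklore] -/
def stepRun (g₀ : ℝ) : B16.RunData where
  flow := ⟨fun _ => g₀, fun _ _ => 0⟩
  Cfg := fun _ => Unit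
  dom := fun _ => Set.univ
  effAction := fun _ _ => 0
  wilsonBG := fun _ _ => 0
  Ek := fun _ _ => 0
  numSites := fun _ => 1
  Repr := fun _ => True
  IndAss := fun _ => True
  ρ := fun k _ => Real.exp k
  χ := fun _ _ => 0
  Sect2Form := fun _ => True

/-- Model M6: run parameters `(K, m, g₀)` ↦ `stepRun g₀`. [folklore] -/
def m6 : B16.Construction := fun P => stepRun P.g0

/-- In M6 the two-sided inequality at step k reduces to `k ≤ E₊`. [folklore] -/
theorem m6_uvIneq_iff (P : B12.RunParams) (k : ℕ) (V : (m6 P).Cfg k) (Em Ep : ℝ) :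
    B16.UVIneq (m6 P) k V Em Ep ↔ (k : ℝ) ≤ Ep := by
  have hχ : (m6 P).χ k V = 0 := rfl
  have hρ : (m6 P).ρ k V = Real.exp k := rfl
  have hN : (m6 P).numSites k = 1 := rfl
  unfold B16.UVIneq
  simp only [hχ, hρ, hN, Nat.cast_one, mul_one, zero_mul]
  constructor
  · rintro ⟨-, h⟩
    exact Real.exp_le_exp.mp h
  · intro h
    exact ⟨(Real.exp_pos _).le, Real.exp_le_exp.mpr h⟩

/-- M6: sign convention. [folklore] -/
theorem m6_sign : B16.SignConventions m6 := fun _ _ _ => le_rfl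

/-- M6: Theorem 1's printed conditional form holds trivially (`Sect2Form ≡ True`). [folklore] -/
theorem m6_thm1 : B16.Thm1Printed m6 := ⟨1, one_pos, fun _ _ _ _ => trivial⟩

/-- A constant run `(K, m, g₀)` with `0 < g₀ ≤ γ` lies in the ]0, γ]-family of M6. [folklore] -/
theorem m6_inInterval (γ : ℝ) (K m : ℕ) (g₀ : ℝ) (hg₀ : 0 < g₀) (hle : g₀ ≤ γ) :
    (m6 ⟨K, m, g₀⟩).flow.InInterval γ K := by
  intro k _
  show 0 < g₀ ∧ g₀ ≤ γ
  exact ⟨hg₀, hle⟩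

/-- M6: the (2.6)-floor holds for every β₀ ≥ 0 at every γ (constant couplings). [folklore] -/
theorem m6_floor (β₀ : ℝ) (hβ₀ : 0 ≤ β₀) (γ : ℝ) : ∀ P : B12.RunParams, (m6 P).flow.InInterval γ P.K →
    ∀ k, k ≤ P.K → (m6 P).flow.g 0 ≤ (1 + β₀) * (m6 P).flow.g k := by
  intro P hP k _
  have h0 : 0 < P.g0 := (hP 0 (Nat.zero_le _)).1
  show P.g0 ≤ (1 + β₀) * P.g0
  nlinarith

/-- M6: (0.1) PER RUN holds, with E₋ = 0 and E₊ = K (depending on the run). [folklore] -/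
theorem m6_perRun : B16.UVBound01PerRun m6 :=
  ⟨1, one_pos, fun P _ => ⟨0, (P.K : ℝ), fun k hk V => (m6_uvIneq_iff P k V 0 P.K).mpr (Nat.cast_le.mpr hk)⟩⟩

/-- M6: [III] Cor. 3's form FAILS at every γ > 0 for EVERY pair of dependence functions (e₋, e₊): the constant run
(K, 0, γ) with K = ⌈e₊(γ)⌉₊ + 1 would need `K ≤ e₊(g_K) = e₊(γ)`. [folklore] -/
theorem m6_not_cor3With (γ : ℝ) (hγ : 0 < γ) (em ep : ℝ → ℝ) : ¬ B16.Cor3With m6 γ em ep := by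
  intro hcor
  have hP := m6_inInterval γ (⌈ep γ⌉₊ + 1) 0 γ hγ le_rfl
  have h := (m6_uvIneq_iff ⟨⌈ep γ⌉₊ + 1, 0, γ⟩ (⌈ep γ⌉₊ + 1) () _ _).mp
    (hcor ⟨⌈ep γ⌉₊ + 1, 0, γ⟩ hP (⌈ep γ⌉₊ + 1) le_rfl ())
  change ((⌈ep γ⌉₊ + 1 : ℕ) : ℝ) ≤ ep γ at h
  push_cast at h
  have := Nat.le_ceil (ep γ)
  linarith

/-- M6: [III] Cor. 3 in its printed conditional form FAILS. [folklore] -/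
theorem m6_not_cor3 : ¬ B16.Cor3_250 m6 := by
  rintro ⟨γ, hγ, em, ep, hcor⟩
  exact m6_not_cor3With γ hγ em ep hcor

/-- M6: hence the pinned end statement (B) fails (its second conjunct). [folklore] -/
theorem m6_not_pin : ¬ B16.EndStatementBPrinted m6 := fun h => m6_not_cor3 h.2

/-- **The per-run reading (with Theorem 1's form and χ_k ≥ 0) does not imply [III] Cor. 3's form**: M6 —
`B16.uvBound01PerRun_of_endStatementBPrinted` is STRICT on the carrier: the dependence FUNCTIONS e±(g_k) of Cor. 3, chosen
before the run, carry cross-run content that (0.1)-per-run (E± depending on the whole run) does not. [folklore] -/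
theorem perRun_not_implies_cor3 :
    ¬ ∀ C : B16.Construction, B16.SignConventions C → B16.Thm1Printed C → B16.UVBound01PerRun C → B16.Cor3_250 C :=
  fun h => m6_not_cor3 (h m6 m6_sign m6_thm1 m6_perRun)

/-- … nor the pin, even with the (2.6)-floor (any β₀ ≥ 0, at every γ). [folklore] -/
theorem perRun_floor_not_implies_pin (β₀ : ℝ) (hβ₀ : 0 ≤ β₀) :
    ¬ ∀ C : B16.Construction, B16.SignConventions C → B16.Thm1Printed C → B16.UVBound01PerRun C →
      (∀ γ : ℝ, 0 < γ → ∀ P : B12.RunParams, (C P).flow.InInterval γ P.K →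
        ∀ k, k ≤ P.K → (C P).flow.g 0 ≤ (1 + β₀) * (C P).flow.g k) →
      B16.EndStatementBPrinted C :=
  fun h => m6_not_pin (h m6 m6_sign m6_thm1 m6_perRun fun γ _ => m6_floor β₀ hβ₀ γ)

end

end Literature.MathematicalPhysics.QuantumFieldTheory.Balaban1983to89.B16PerBareCounter
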